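import Literature.Combinatorics.StablePolynomials.HThetaStability
import Literature.Combinatorics.StablePolynomials.Limits
import HarnessLib

/-!
# Hard Lieb–Sokal lemmas (Borcea–Brändén II, §6: Lemma 6.1 and Corollary 6.2)

J. Borcea, P. Brändén, *The Lee–Yang and Pólya–Schur programs. II.*, Comm. Pure Appl. Math. 62 (2009)
1595–1631 (arXiv:0809.3087), §6:

> **Lemma 6.1.** Let `n, d ∈ ℕ` with `n ≥ 2` and let `κ ∈ ℕⁿ` be such that `κ_1 = κ_2 = d`. Define a linear
> operator `T_d : ℂ_κ[z_1,…,z_n] → ℂ_κ[z_1,…,z_n]` by `T_d(f) = (1/d!) Σ_{k=0}^d ∂^d f/(∂z_1^k ∂z_2^{d-k})`.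
> Then `T_d` preserves `H_θ`-stability for any `0 ≤ θ < 2π`.
>
> *Proof.* The symbol of `T_d`, i.e., the `2n`-variable polynomial `T_d[(z+w)^κ]`, is
> `(1/d!)(z_3+w_3)^{κ_3}⋯(z_n+w_n)^{κ_n} Σ_{k=0}^d (d!/(d-k)!)(d!/k!)(z_1+w_1)^{d-k}(z_2+w_2)^k
>  = (z_1+z_2+w_1+w_2)^d (z_3+w_3)^{κ_3}⋯(z_n+w_n)^{κ_n}`, which is `H_θ`-stable. The conclusion follows from
> Theorem 3.1.
>
> **Corollary 6.2.** … `S_d[Σ_{k=0}^d z_1^k Q_k(z_2,…,z_n)] = (1/d!) Σ_{k=0}^d k! (∂/∂z_2)^{d-k} Q_k(z_2,…,z_n)`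
> and `R_d[Σ_{k=0}^d z_1^k Q_k(z_2,…,z_n)] = (1/d!) Σ_{k=0}^d (-1)^k (d-k)! (∂/∂z_2)^k Q_k(z_2,…,z_n)`.
> Then `S_d` and `R_d` preserve (`H_0`-)stability up to degree `κ`.

Here the two distinguished variables are any `a ≠ b` in the index type `σ` (so `n = |σ| ≥ 2`); `T_d` is
`hardLiebSokalOp a b d`; "preserves `H_θ`-stability" is, as in Theorem 3.1 (tree:
`BorceaBranden_hThetaStabilityPreserver_iff`), "maps `H_θ`-stable polynomials of `ℂ_κ[z]` to `H_θ`-stable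
polynomials or to `0`". For Corollary 6.2 the polynomials `Q_k(z_2,…,z_n)` are polynomials in the variables
`{i // i ≠ a}`, embedded by `rename Subtype.val`, and `S_d` is obtained from `T_d` by the printed route
"Lemma 6.1 and Remark 3.1": `S_d(f) = T_d(f)|_{z_1 = 0}` (specialisation at the real point `0`, the tree's
`IsUpperHalfPlaneStable.specialize_real`).

`R_d` is `S_d` after the inversion `z_1 ↦ -1/z_1` of part I, Lemma 1.7 (3): `R_d[Σ_k z_1^k Q_k] =
S_d[z_1^d f(-1/z_1,…)] = S_d[Σ_k (-1)^{d-k} z_1^k Q_{d-k}]` (`hardLiebSokalR_eq`), the inverted polynomial being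
stable with the original (`isUpperHalfPlaneStable_sum_X_pow_mul_reverse`).

Remark 6.1 (`T_d(f)` is a polynomial in `z_1 + z_2, z_3, …, z_n`) is §6 below: on monomials
`T_d[z_a^i z_b^j q] = (i! j!/(d! (i+j-d)!)) (z_a + z_b)^{i+j-d} q` (`q` free of `z_a, z_b`, `i, j ≤ d`), whence the
printed identity `F(z) = F(z_a + z_b, 0, …)` for `F = T_d(f)`, the form `T_d(f) = G(z_a ↦ z_a + z_b)` with `G` free of
`z_b`, and the translation invariance `F(z_a + t, z_b - t, …) = F(z)`.

## Contents

* `hardLiebSokalOp a b d` (`T_d`), `hardLiebSokalOp_apply`.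
* `iterate_pderiv_mul_of_right`, `iterate_pderiv_X_add_C_pow`, `hardLiebSokalOp_prod_X_add_C_pow` (the symbol
  computation `T_d[(z+w)^κ] = (z_1+z_2+w_1+w_2)^d Π_{i≥3}(z_i+w_i)^{κ_i}`).
* **`hardLiebSokal`** — Lemma 6.1 (every `θ`); `hardLiebSokal_stable` (`θ = 0`).
* `hardLiebSokalS`, `bind₁_hardLiebSokalOp_eq` (`S_d = T_d|_{z_a=0}`), **`hardLiebSokalS_stable_or_eq_zero`** —
  Corollary 6.2 for `S_d`.
* `hardLiebSokalR`, `hardLiebSokalR_eq` (`R_d = S_d ∘` inversion), `degreeOf_sum_X_pow_mul_rename_le`,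
  `isUpperHalfPlaneStable_sum_X_pow_mul_reverse`, **`hardLiebSokalR_stable_or_eq_zero`** — Corollary 6.2 for `R_d`.
* `iterate_pderiv_X_pow_mul_X_pow_mul`, **`hardLiebSokalOp_X_pow_mul_X_pow_mul`** (the monomial formula),
  **`bind₁_hardLiebSokalOp_add_zero`** (`F(z) = F(z_a+z_b, 0, …)`), **`exists_hardLiebSokalOp_eq_bind₁_add`**
  (Remark 6.1: `T_d(f) = G(z_a + z_b, z_3, …)`), `bind₁_hardLiebSokalOp_translate` — Remark 6.1.

## References

* [BorceaBranden2009II] J. Borcea, P. Brändén, Comm. Pure Appl. Math. 62 (2009) 1595–1631, §6 Lemma 6.1,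
  Remark 6.1, Cor. 6.2, §3 Thm 3.1, Remark 3.1.
-/

noncomputable section

open MvPolynomial Finset

open scoped Nat

namespace Literature.Combinatorics.StablePolynomials

variable {σ : Type*} [Fintype σ] [DecidableEq σ]

/-! ## §1 The operator `T_d` -/

section Operator

/-- **`T_d(f) = (1/d!) Σ_{k=0}^d ∂^d f/(∂z_a^k ∂z_b^{d-k})`** as a `ℂ`-linear operator on `ℂ[z_σ]` (`a, b` the two
distinguished variables). [cite: BorceaBranden2009II, §6 Lemma 6.1 (definition of `T_d`)] -/
def hardLiebSokalOp (a b : σ) (d : ℕ) : MvPolynomial σ ℂ →ₗ[ℂ] MvPolynomial σ ℂ :=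
  ((d ! : ℕ) : ℂ)⁻¹ • ∑ k ∈ range (d + 1),
    ((pderiv (R := ℂ) a).toLinearMap ^ k) ∘ₗ ((pderiv (R := ℂ) b).toLinearMap ^ (d - k))

omit [Fintype σ] [DecidableEq σ] in
/-- `T_d(f) = (1/d!) Σ_k ∂_a^k ∂_b^{d-k} f`. [cite: BorceaBranden2009II, §6 Lemma 6.1] -/
theorem hardLiebSokalOp_apply (a b : σ) (d : ℕ) (f : MvPolynomial σ ℂ) :
    hardLiebSokalOp a b d f =
      ((d ! : ℕ) : ℂ)⁻¹ • ∑ k ∈ range (d + 1), (pderiv a)^[k] ((pderiv b)^[d - k] f) := by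
  rw [hardLiebSokalOp, LinearMap.smul_apply, LinearMap.sum_apply]
  congr 1
  refine sum_congr rfl fun k _ => ?_
  rw [LinearMap.comp_apply, Module.End.pow_apply, Module.End.pow_apply]
  rfl

end Operator

/-! ## §2 The symbol of `T_d` -/

section Symbol

omit [Fintype σ] [DecidableEq σ] in
/-- Iterated `∂_a` of `p · q` with `∂_a q = 0`. [cite: BorceaBranden2009II, §6 proof of Lemma 6.1] -/
theorem iterate_pderiv_mul_of_right (a : σ) {q : MvPolynomial σ ℂ} (hq : pderiv a q = 0)
    (p : MvPolynomial σ ℂ) (k : ℕ) : (pderiv a)^[k] (p * q) = (pderiv a)^[k] p * q := by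
  induction k generalizing p with
  | zero => rfl
  | succ k ih =>
    rw [Function.iterate_succ_apply, Function.iterate_succ_apply, pderiv_mul, hq, mul_zero, add_zero, ih]

omit [Fintype σ] [DecidableEq σ] in
/-- Iterated `∂_a` commutes with scalars. [cite: BorceaBranden2009II, §6 proof of Lemma 6.1] -/
theorem iterate_pderiv_smul (a : σ) (c : ℂ) (p : MvPolynomial σ ℂ) (k : ℕ) :
    (pderiv a)^[k] (c • p) = c • (pderiv a)^[k] p := by
  induction k generalizing p with
  | zero => rfl
  | succ k ih => rw [Function.iterate_succ_apply, Function.iterate_succ_apply, Derivation.map_smul, ih]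

omit [Fintype σ] [DecidableEq σ] in
/-- **`∂_a^k (z_a + w)^d = d(d-1)⋯(d-k+1) (z_a + w)^{d-k}`.** [cite: BorceaBranden2009II, §6 proof of
Lemma 6.1 ("`d!/(d-k)! (z_1+w_1)^{d-k}`")] -/
theorem iterate_pderiv_X_add_C_pow (a : σ) (w : ℂ) (d k : ℕ) :
    (pderiv a)^[k] ((X a + C w) ^ d : MvPolynomial σ ℂ) = ((d.descFactorial k : ℕ) : ℂ) • (X a + C w) ^ (d - k) := by
  induction k with
  | zero => rw [Function.iterate_zero_apply, Nat.descFactorial_zero, Nat.cast_one, one_smul, Nat.sub_zero]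
  | succ k ih =>
    rw [Function.iterate_succ_apply', ih, Derivation.map_smul, pderiv_pow, map_add, pderiv_X_self, pderiv_C,
      add_zero, mul_one, Nat.descFactorial_succ, Nat.sub_add_eq]
    simp only [smul_eq_C_mul, Nat.cast_mul, _root_.map_mul, map_natCast]
    ring

omit [Fintype σ] in
/-- `∂_a` kills a product of factors `(z_i + w_i)^{m_i}` over `i ≠ a`. [cite: BorceaBranden2009II, §6 proof of
Lemma 6.1] -/
theorem pderiv_prod_X_add_C_pow_eq_zero (a : σ) (S : Finset σ) (ha : a ∉ S) (w : σ → ℂ) (m : σ → ℕ) :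
    pderiv a (∏ i ∈ S, (X i + C (w i)) ^ m i : MvPolynomial σ ℂ) = 0 := by
  induction S using Finset.induction_on with
  | empty => rw [prod_empty, pderiv_one]
  | insert j S hj ih =>
    have hja : j ≠ a := fun h => ha (h ▸ mem_insert_self j S)
    rw [prod_insert hj, pderiv_mul, ih (fun h => ha (mem_insert_of_mem h)), mul_zero, add_zero, pderiv_pow,
      map_add, pderiv_X_of_ne hja, pderiv_C, add_zero, mul_zero, zero_mul]

/-- `d!⁻¹ · descFactorial(d,k) · descFactorial(d,d-k) = binom(d,k)` (`k ≤ d`).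
[cite: BorceaBranden2009II, §6 proof of Lemma 6.1 (the coefficients `(d!/(d-k)!)(d!/k!)/d!`)] -/
private theorem descFactorial_mul_descFactorial {d k : ℕ} (hk : k ≤ d) :
    ((d ! : ℕ) : ℂ)⁻¹ * (((d.descFactorial k : ℕ) : ℂ) * ((d.descFactorial (d - k) : ℕ) : ℂ)) =
      ((d.choose k : ℕ) : ℂ) := by
  have h1 : d.descFactorial k * d.descFactorial (d - k) = d ! * d.choose k := by
    rw [Nat.descFactorial_eq_factorial_mul_choose, Nat.descFactorial_eq_factorial_mul_choose,
      Nat.choose_symm hk]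
    have h2 := Nat.choose_mul_factorial_mul_factorial hk
    calc k ! * d.choose k * ((d - k)! * d.choose k) = (d.choose k * k ! * (d - k)!) * d.choose k := by ring
      _ = d ! * d.choose k := by rw [h2]
  have hd : ((d ! : ℕ) : ℂ) ≠ 0 := Nat.cast_ne_zero.2 (Nat.factorial_ne_zero d)
  rw [← Nat.cast_mul, h1, Nat.cast_mul, ← mul_assoc, inv_mul_cancel₀ hd, one_mul]

/-- **The symbol computation**: for `κ_a = κ_b = d`,
`T_d[Π_i (z_i + w_i)^{κ_i}] = ((z_a + w_a) + (z_b + w_b))^d · Π_{i ≠ a,b} (z_i + w_i)^{κ_i}`.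
[cite: BorceaBranden2009II, §6 proof of Lemma 6.1 (displayed symbol identity)] -/
theorem hardLiebSokalOp_prod_X_add_C_pow {a b : σ} (hab : a ≠ b) {κ : σ → ℕ} {d : ℕ} (ha : κ a = d)
    (hb : κ b = d) (w : σ → ℂ) :
    hardLiebSokalOp a b d (∏ i, (X i + C (w i)) ^ κ i) =
      ((X a + C (w a)) + (X b + C (w b))) ^ d * ∏ i ∈ (univ.erase a).erase b, (X i + C (w i)) ^ κ i := by
  set R : MvPolynomial σ ℂ := ∏ i ∈ (univ.erase a).erase b, (X i + C (w i)) ^ κ i with hR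
  have hbR : b ∉ (univ.erase a).erase b := fun h => (mem_erase.1 h).1 rfl
  have haR : a ∉ (univ.erase a).erase b := fun h => (mem_erase.1 (mem_erase.1 h).2).1 rfl
  have hRa : pderiv a R = 0 := pderiv_prod_X_add_C_pow_eq_zero a _ haR w κ
  have hRb : pderiv b R = 0 := pderiv_prod_X_add_C_pow_eq_zero b _ hbR w κ
  have hPa_b : pderiv b ((X a + C (w a)) ^ d : MvPolynomial σ ℂ) = 0 := by
    rw [pderiv_pow, map_add, pderiv_X_of_ne hab, pderiv_C, add_zero, mul_zero]
  have hPb_a : ∀ m : ℕ, pderiv a ((X b + C (w b)) ^ m : MvPolynomial σ ℂ) = 0 := fun m => by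
    rw [pderiv_pow, map_add, pderiv_X_of_ne (Ne.symm hab), pderiv_C, add_zero, mul_zero]
  -- split off the two distinguished factors
  have hsplit : (∏ i, (X i + C (w i)) ^ κ i : MvPolynomial σ ℂ) =
      (X b + C (w b)) ^ d * ((X a + C (w a)) ^ d * R) := by
    rw [← mul_prod_erase univ _ (mem_univ a), ← mul_prod_erase (univ.erase a) _ (mem_erase.2 ⟨Ne.symm hab, mem_univ b⟩),
      ha, hb, ← mul_assoc, ← mul_assoc, mul_comm ((X a + C (w a)) ^ d)]
  rw [hardLiebSokalOp_apply, hsplit]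
  -- termwise
  have hterm : ∀ k ∈ range (d + 1), (pderiv a)^[k] ((pderiv b)^[d - k]
      ((X b + C (w b)) ^ d * ((X a + C (w a)) ^ d * R) : MvPolynomial σ ℂ)) =
      (((d.descFactorial k : ℕ) : ℂ) * ((d.descFactorial (d - k) : ℕ) : ℂ)) •
        ((X a + C (w a)) ^ (d - k) * (X b + C (w b)) ^ (d - (d - k)) * R) := by
    intro k _
    have hq : pderiv b ((X a + C (w a)) ^ d * R : MvPolynomial σ ℂ) = 0 := by
      rw [pderiv_mul, hPa_b, hRb, zero_mul, mul_zero, add_zero]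
    rw [iterate_pderiv_mul_of_right b hq _ (d - k), iterate_pderiv_X_add_C_pow, smul_mul_assoc,
      iterate_pderiv_smul, mul_left_comm, iterate_pderiv_mul_of_right a (by rw [pderiv_mul, hPb_a, hRa,
        zero_mul, mul_zero, add_zero]) _ k, iterate_pderiv_X_add_C_pow, smul_mul_assoc, smul_smul, mul_comm
        (((d.descFactorial (d - k) : ℕ) : ℂ))]
    congr 1
    ring
  rw [sum_congr rfl hterm, smul_sum]
  simp_rw [smul_smul]
  -- binomial theorem
  rw [add_comm ((X a + C (w a)) : MvPolynomial σ ℂ), add_pow, sum_mul]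
  refine sum_congr rfl fun k hk => ?_
  have hk' : k ≤ d := Nat.lt_succ_iff.1 (mem_range.1 hk)
  rw [descFactorial_mul_descFactorial hk', Nat.sub_sub_self hk', smul_eq_C_mul, map_natCast]
  ring

/-- **The symbol of `T_d` is `H_θ`-stable**: `T_d[(z+w)^κ](z,w) ≠ 0` for `z, w ∈ H_θⁿ` (each `z_i + w_i`, and
`z_a + z_b + w_a + w_b`, lie in the open convex cone `H_θ`). [cite: BorceaBranden2009II, §6 proof of Lemma 6.1
("which is `H_θ`-stable")] -/
theorem isHThetaStable_boundedDegreeSymbol_hardLiebSokalOp (θ : ℝ) {a b : σ} (hab : a ≠ b) {κ : σ → ℕ}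
    {d : ℕ} (ha : κ a = d) (hb : κ b = d) :
    IsHThetaStable θ (boundedDegreeSymbol κ (hardLiebSokalOp a b d)) := by
  rw [isHThetaStable_boundedDegreeSymbol_iff]
  intro z w hz hw
  rw [hardLiebSokalOp_prod_X_add_C_pow hab ha hb w, _root_.map_mul, _root_.map_pow, _root_.map_prod]
  simp only [_root_.map_add, _root_.map_pow, eval_X, eval_C]
  have hsum : ∀ i, thetaUnit θ * (z i + w i) ≠ 0 := fun i h => by
    have h2 : (thetaUnit θ * (z i + w i)).im = (thetaUnit θ * z i).im + (thetaUnit θ * w i).im := by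
      rw [mul_add, Complex.add_im]
    have h3 := add_pos (hz i) (hw i)
    rw [← h2, h, Complex.zero_im] at h3
    exact lt_irrefl _ h3
  have hne : ∀ i, z i + w i ≠ 0 := fun i h => hsum i (by rw [h, mul_zero])
  refine mul_ne_zero (pow_ne_zero _ fun h => ?_) (prod_ne_zero_iff.2 fun i _ => pow_ne_zero _ (hne i))
  have h2 : (thetaUnit θ * (z a + w a + (z b + w b))).im =
      ((thetaUnit θ * z a).im + (thetaUnit θ * w a).im) + ((thetaUnit θ * z b).im + (thetaUnit θ * w b).im) := by
    simp only [mul_add, Complex.add_im]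
  have h3 := add_pos (add_pos (hz a) (hw a)) (add_pos (hz b) (hw b))
  rw [← h2, h, mul_zero, Complex.zero_im] at h3
  exact lt_irrefl _ h3

end Symbol

/-! ## §3 Lemma 6.1 -/

section Lemma61

/-- **Borcea–Brändén II, Lemma 6.1 (hard Lieb–Sokal lemma), every `θ`.** For `a ≠ b`, `κ_a = κ_b = d`, the
operator `T_d(f) = (1/d!) Σ_{k=0}^d ∂^d f/(∂z_a^k ∂z_b^{d-k})` maps every `H_θ`-stable `f ∈ ℂ_κ[z_σ]` to an
`H_θ`-stable polynomial or to `0`. Proof as printed: its symbol is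
`(z_a+z_b+w_a+w_b)^d Π_{i ≠ a,b} (z_i+w_i)^{κ_i}`, which is `H_θ`-stable; Theorem 3.1.
[cite: BorceaBranden2009II, §6 Lemma 6.1] -/
theorem hardLiebSokal (θ : ℝ) {a b : σ} (hab : a ≠ b) {κ : σ → ℕ} {d : ℕ} (ha : κ a = d) (hb : κ b = d)
    {f : MvPolynomial σ ℂ} (hf : ∀ i, degreeOf i f ≤ κ i) (hs : IsHThetaStable θ f) :
    IsHThetaStable θ (hardLiebSokalOp a b d f) ∨ hardLiebSokalOp a b d f = 0 :=
  (BorceaBranden_hThetaStabilityPreserver_iff θ κ (hardLiebSokalOp a b d)).2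
    (Or.inr (isHThetaStable_boundedDegreeSymbol_hardLiebSokalOp θ hab ha hb)) f hf hs

/-- **Lemma 6.1 for `H_0 = H`** (stable polynomials). [cite: BorceaBranden2009II, §6 Lemma 6.1 (`θ = 0`)] -/
theorem hardLiebSokal_stable {a b : σ} (hab : a ≠ b) {κ : σ → ℕ} {d : ℕ} (ha : κ a = d) (hb : κ b = d)
    {f : MvPolynomial σ ℂ} (hf : ∀ i, degreeOf i f ≤ κ i) (hs : IsUpperHalfPlaneStable f) :
    IsUpperHalfPlaneStable (hardLiebSokalOp a b d f) ∨ hardLiebSokalOp a b d f = 0 := by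
  rw [← isHThetaStable_zero_iff] at hs ⊢
  exact hardLiebSokal 0 hab ha hb hf hs

end Lemma61

/-! ## §4 Corollary 6.2: the operator `S_d` -/

section Cor62

variable (a : σ)

omit [Fintype σ] [DecidableEq σ] in
/-- A polynomial in the variables `≠ a` does not involve `z_a`: `∂_a Q(z_2,…,z_n) = 0`.
[cite: BorceaBranden2009II, §6 Cor. 6.2 (the `Q_k(z_2,…,z_n)`)] -/
theorem pderiv_rename_val_eq_zero (q : MvPolynomial {i // i ≠ a} ℂ) :
    pderiv a (rename (Subtype.val : {i // i ≠ a} → σ) q) = 0 := by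
  induction q using MvPolynomial.induction_on with
  | C c => rw [rename_C, pderiv_C]
  | add p q hp hq => rw [map_add, map_add, hp, hq, add_zero]
  | mul_X p i hp =>
    rw [_root_.map_mul, rename_X, pderiv_mul, hp, zero_mul, zero_add, pderiv_X_of_ne i.2, mul_zero]

omit [Fintype σ] [DecidableEq σ] in
/-- `∂_{z_2}` commutes with the embedding of `ℂ[z_2,…,z_n]`. [cite: BorceaBranden2009II, §6 Cor. 6.2] -/
theorem iterate_pderiv_rename_val (b' : {i // i ≠ a}) (q : MvPolynomial {i // i ≠ a} ℂ) (m : ℕ) :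
    (pderiv (b' : σ))^[m] (rename (Subtype.val : {i // i ≠ a} → σ) q) =
      rename (Subtype.val : {i // i ≠ a} → σ) ((pderiv b')^[m] q) := by
  induction m generalizing q with
  | zero => rfl
  | succ m ih =>
    rw [Function.iterate_succ_apply, Function.iterate_succ_apply, pderiv_rename Subtype.val_injective, ih]

omit [Fintype σ] [DecidableEq σ] in
/-- Iterated `∂_a` of `q · p` with `∂_a q = 0`. [cite: BorceaBranden2009II, §6 proof of Lemma 6.1] -/
theorem iterate_pderiv_mul_of_left {q : MvPolynomial σ ℂ} (hq : pderiv a q = 0) (p : MvPolynomial σ ℂ) (k : ℕ) :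
    (pderiv a)^[k] (q * p) = q * (pderiv a)^[k] p := by
  rw [mul_comm, iterate_pderiv_mul_of_right a hq p k, mul_comm]

omit [Fintype σ] [DecidableEq σ] in
/-- `∂_a^j z_a^k = k(k-1)⋯(k-j+1) z_a^{k-j}` (zero for `j > k`). [cite: BorceaBranden2009II, §6 Cor. 6.2 (the
factors `k!`)] -/
theorem iterate_pderiv_X_pow (k j : ℕ) :
    (pderiv a)^[j] (X a ^ k : MvPolynomial σ ℂ) = ((k.descFactorial j : ℕ) : ℂ) • X a ^ (k - j) := by
  have h := iterate_pderiv_X_add_C_pow a 0 k j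
  rwa [map_zero, add_zero] at h

omit [Fintype σ] in
/-- Setting `z_a := c` does not affect a polynomial in the other variables. [cite: BorceaBranden2009II, §3
Remark 3.1 / §6 Cor. 6.2] -/
theorem bind₁_update_rename_val (c : MvPolynomial σ ℂ) (q : MvPolynomial {i // i ≠ a} ℂ) :
    bind₁ (Function.update X a c) (rename (Subtype.val : {i // i ≠ a} → σ) q) =
      rename (Subtype.val : {i // i ≠ a} → σ) q := by
  rw [bind₁_rename]
  have h : (Function.update X a c) ∘ (Subtype.val : {i // i ≠ a} → σ) = X ∘ Subtype.val :=
    funext fun i => Function.update_of_ne i.2 _ _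
  rw [h, ← aeval_eq_bind₁, ← rename_eq_aeval]

omit [Fintype σ] [DecidableEq σ] in
/-- Iterated partial derivatives are additive over finite sums. [cite: BorceaBranden2009II, §6 Cor. 6.2] -/
theorem iterate_pderiv_sum (i : σ) (m : ℕ) (s : Finset ℕ) (g : ℕ → MvPolynomial σ ℂ) :
    (pderiv i)^[m] (∑ k ∈ s, g k) = ∑ k ∈ s, (pderiv i)^[m] (g k) := by
  induction m with
  | zero => rfl
  | succ m ih =>
    rw [Function.iterate_succ_apply', ih, map_sum]
    simp only [Function.iterate_succ_apply']

omit [Fintype σ] in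
/-- Stability descends along the embedding of `ℂ[z_σ ∖ {a}]` (extend a point of `H^{σ∖a}` by `z_a = i`).
[cite: BorceaBranden2009II, §1 (definition of stability)] -/
theorem isUpperHalfPlaneStable_of_rename_val {q : MvPolynomial {i // i ≠ a} ℂ}
    (h : IsUpperHalfPlaneStable (rename (Subtype.val : {i // i ≠ a} → σ) q)) : IsUpperHalfPlaneStable q := by
  intro z hz
  let Z : σ → ℂ := fun i => if hi : i = a then Complex.I else z ⟨i, hi⟩
  have hZ : ∀ i, 0 < (Z i).im := fun i => by
    by_cases hi : i = a
    · simp [Z, hi]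
    · simp only [Z, dif_neg hi]
      exact hz _
  have h2 := h Z hZ
  rw [eval_rename] at h2
  have hZ' : Z ∘ (Subtype.val : {i // i ≠ a} → σ) = z := funext fun j => by
    simp only [Function.comp_apply, Z, dif_neg j.2]
  rwa [hZ'] at h2

/-- **The operator `S_d`** on the data `(Q_k)_{k ≤ d}`, `Q_k ∈ ℂ[z_2,…,z_n]` (variables `≠ a`; `b'` the index of
`z_2`): `S_d[Σ_k z_a^k Q_k] = (1/d!) Σ_{k=0}^d k! (∂/∂z_{b'})^{d-k} Q_k`. [cite: BorceaBranden2009II, §6 Cor. 6.2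
(definition of `S_d`)] -/
def hardLiebSokalS (b' : {i // i ≠ a}) (d : ℕ) (Q : ℕ → MvPolynomial {i // i ≠ a} ℂ) :
    MvPolynomial {i // i ≠ a} ℂ :=
  ((d ! : ℕ) : ℂ)⁻¹ • ∑ k ∈ range (d + 1), ((k ! : ℕ) : ℂ) • (pderiv b')^[d - k] (Q k)

omit [Fintype σ] in
/-- **`S_d = T_d(·)|_{z_a = 0}`** on `f = Σ_{k ≤ d} z_a^k Q_k(z_2,…,z_n)`: in `T_d(f) = (1/d!) Σ_{j,k} (k)_j z_a^{k-j}
∂_{z_2}^{d-j} Q_k` only the terms `j = k` survive at `z_a = 0`. [cite: BorceaBranden2009II, §6 Cor. 6.2 ("Using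
Lemma 6.1 and Remark 3.1")] -/
theorem bind₁_hardLiebSokalOp_eq (b' : {i // i ≠ a}) (d : ℕ) (Q : ℕ → MvPolynomial {i // i ≠ a} ℂ) :
    bind₁ (Function.update X a (C 0))
        (hardLiebSokalOp a b' d (∑ k ∈ range (d + 1), X a ^ k * rename (Subtype.val : {i // i ≠ a} → σ) (Q k))) =
      rename (Subtype.val : {i // i ≠ a} → σ) (hardLiebSokalS a b' d Q) := by
  have hb : (b' : σ) ≠ a := b'.2
  -- the double sum
  have h1 : ∀ j, (pderiv a)^[j] ((pderiv (b' : σ))^[d - j]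
      (∑ k ∈ range (d + 1), X a ^ k * rename (Subtype.val : {i // i ≠ a} → σ) (Q k))) =
      ∑ k ∈ range (d + 1), ((k.descFactorial j : ℕ) : ℂ) •
        (X a ^ (k - j) * rename (Subtype.val : {i // i ≠ a} → σ) ((pderiv b')^[d - j] (Q k))) := by
    intro j
    rw [iterate_pderiv_sum, iterate_pderiv_sum]
    refine sum_congr rfl fun k _ => ?_
    have hXb : pderiv (b' : σ) (X a ^ k : MvPolynomial σ ℂ) = 0 := by
      rw [pderiv_pow, pderiv_X_of_ne (Ne.symm hb), mul_zero]
    rw [iterate_pderiv_mul_of_left (b' : σ) hXb, iterate_pderiv_rename_val a b',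
      iterate_pderiv_mul_of_right a (pderiv_rename_val_eq_zero a _), iterate_pderiv_X_pow, smul_mul_assoc]
  -- specialise `z_a := 0` termwise
  have h2 : ∀ j k, bind₁ (Function.update X a (C 0)) (((k.descFactorial j : ℕ) : ℂ) •
      (X a ^ (k - j) * rename (Subtype.val : {i // i ≠ a} → σ) ((pderiv b')^[d - j] (Q k))) : MvPolynomial σ ℂ) =
      (((k.descFactorial j : ℕ) : ℂ) * (0 : ℂ) ^ (k - j)) •
        rename (Subtype.val : {i // i ≠ a} → σ) ((pderiv b')^[d - j] (Q k)) := by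
    intro j k
    rw [map_smul, _root_.map_mul, map_pow, bind₁_X_right, Function.update_self, bind₁_update_rename_val, ← C_pow,
      ← smul_eq_C_mul, smul_smul]
  rw [hardLiebSokalOp_apply, sum_congr rfl fun j _ => h1 j, map_smul, map_sum, hardLiebSokalS, map_smul, map_sum]
  congr 1
  simp_rw [map_sum, h2]
  rw [sum_comm]
  refine sum_congr rfl fun k hk => ?_
  rw [map_smul, sum_eq_single_of_mem k hk fun j _ hjk => ?_]
  · rw [Nat.descFactorial_self, Nat.sub_self, pow_zero, mul_one]
  · rcases Nat.lt_or_gt_of_ne hjk with hlt | hgt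
    · rw [zero_pow (Nat.sub_ne_zero_of_lt hlt), mul_zero, zero_smul]
    · rw [Nat.descFactorial_eq_zero_iff_lt.2 hgt, Nat.cast_zero, zero_mul, zero_smul]

/-- **Borcea–Brändén II, Corollary 6.2 for `S_d`.** Let `a ≠ b'`, `κ_a = κ_{b'} = d`, and
`f = Σ_{k=0}^d z_a^k Q_k(z_2,…,z_n) ∈ ℂ_κ[z_σ]` be stable. Then
`S_d(f) = (1/d!) Σ_{k=0}^d k! (∂/∂z_{b'})^{d-k} Q_k` is stable or identically zero ("`S_d` preserves (`H_0`-)stability up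
to degree `κ`"). Proof as indicated there: `S_d(f) = T_d(f)|_{z_a = 0}` (Lemma 6.1 and the real specialisation of
Remark 3.1 / part I Lemma 1.7 (1)). [cite: BorceaBranden2009II, §6 Cor. 6.2] -/
theorem hardLiebSokalS_stable_or_eq_zero {a : σ} (b' : {i // i ≠ a}) {κ : σ → ℕ} {d : ℕ} (ha : κ a = d)
    (hb : κ b' = d) (Q : ℕ → MvPolynomial {i // i ≠ a} ℂ)
    (hf : ∀ i, degreeOf i (∑ k ∈ range (d + 1), X a ^ k * rename (Subtype.val : {i // i ≠ a} → σ) (Q k) :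
      MvPolynomial σ ℂ) ≤ κ i)
    (hs : IsUpperHalfPlaneStable (∑ k ∈ range (d + 1), X a ^ k * rename (Subtype.val : {i // i ≠ a} → σ) (Q k) :
      MvPolynomial σ ℂ)) :
    IsUpperHalfPlaneStable (hardLiebSokalS a b' d Q) ∨ hardLiebSokalS a b' d Q = 0 := by
  have hab : a ≠ (b' : σ) := fun h => b'.2 h.symm
  have key := bind₁_hardLiebSokalOp_eq a b' d Q
  rcases hardLiebSokal_stable hab ha hb hf hs with h | h
  · rcases h.specialize_real a 0 with h0 | h0
    · right
      rw [Complex.ofReal_zero, key] at h0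
      exact rename_injective _ Subtype.val_injective (by rw [h0, map_zero])
    · left
      rw [Complex.ofReal_zero, key] at h0
      exact isUpperHalfPlaneStable_of_rename_val a h0
  · right
    rw [h, map_zero] at key
    exact rename_injective _ Subtype.val_injective (by rw [← key, map_zero])

end Cor62

/-! ## §5 Corollary 6.2: the operator `R_d` -/

section Cor62R

variable (a : σ)

/-- **The operator `R_d` of Corollary 6.2** on `f = Σ_{k=0}^d z_a^k Q_k` (given by `(Q_k)_k`):
`R_d(f) = (1/d!) Σ_{k=0}^d (-1)^k (d-k)! (∂/∂z_{b'})^k Q_k`. [cite: BorceaBranden2009II, §6 Cor. 6.2 (definition of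
`R_d`)] -/
def hardLiebSokalR (b' : {i // i ≠ a}) (d : ℕ) (Q : ℕ → MvPolynomial {i // i ≠ a} ℂ) :
    MvPolynomial {i // i ≠ a} ℂ :=
  ((d ! : ℕ) : ℂ)⁻¹ • ∑ k ∈ range (d + 1), ((-1 : ℂ) ^ k * (((d - k) ! : ℕ) : ℂ)) • (pderiv b')^[k] (Q k)

omit [Fintype σ] [DecidableEq σ] in
/-- **`R_d = S_d ∘ (z_a ↦ -1/z_a)`**: `R_d[(Q_k)_k] = S_d[((-1)^{d-k} Q_{d-k})_k]`, i.e. `R_d(f) = S_d(z_a^d f(-1/z_a,…))`.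
[cite: BorceaBranden2009II, §6 Cor. 6.2 ("Using Lemma 6.1 and Remark 3.1")] [cite: BorceaBranden2009, §1
Lemma 1.7 (3)] -/
theorem hardLiebSokalR_eq (b' : {i // i ≠ a}) (d : ℕ) (Q : ℕ → MvPolynomial {i // i ≠ a} ℂ) :
    hardLiebSokalR a b' d Q = hardLiebSokalS a b' d fun k => (-1 : ℂ) ^ (d - k) • Q (d - k) := by
  rw [hardLiebSokalR, hardLiebSokalS]
  congr 1
  rw [← sum_range_reflect]
  refine sum_congr rfl fun k hk => ?_
  have hk' : k ≤ d := Nat.lt_succ_iff.1 (mem_range.1 hk)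
  rw [Nat.add_sub_cancel, Nat.sub_sub_self hk', iterate_pderiv_smul, smul_smul, mul_comm]

omit [Fintype σ] [DecidableEq σ] in
/-- `z_a` does not occur in `Q(z_2,…,z_n)`. [cite: BorceaBranden2009II, §6 Cor. 6.2] -/
theorem degreeOf_rename_val_eq_zero (q : MvPolynomial {i // i ≠ a} ℂ) :
    degreeOf a (rename (Subtype.val : {i // i ≠ a} → σ) q) = 0 := by
  induction q using MvPolynomial.induction_on with
  | C c => rw [rename_C, degreeOf_C]
  | add p q hp hq =>
    rw [map_add]
    exact Nat.le_zero.1 ((degreeOf_add_le _ _ _).trans (max_le hp.le hq.le))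
  | mul_X p i hp => rw [_root_.map_mul, rename_X, degreeOf_mul_X_of_ne _ (fun h => i.2 h.symm), hp]

omit [Fintype σ] in
/-- **`Σ_{k≤d} z_a^k Q_k ∈ ℂ_κ[z]`** when `d ≤ κ_a` and every `Q_k ∈ ℂ_κ[z_2,…,z_n]`.
[cite: BorceaBranden2009II, §6 Cor. 6.2 (`S_d, R_d : ℂ_κ[z] → ℂ_κ[z]`)] -/
theorem degreeOf_sum_X_pow_mul_rename_le {κ : σ → ℕ} {d : ℕ} (hd : d ≤ κ a)
    {Q : ℕ → MvPolynomial {i // i ≠ a} ℂ} (hQ : ∀ k ∈ range (d + 1), ∀ i' : {i // i ≠ a}, degreeOf i' (Q k) ≤ κ i')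
    (i : σ) :
    degreeOf i (∑ k ∈ range (d + 1), X a ^ k * rename (Subtype.val : {i // i ≠ a} → σ) (Q k) :
      MvPolynomial σ ℂ) ≤ κ i := by
  refine (degreeOf_sum_le _ _ _).trans (Finset.sup_le fun k hk => ?_)
  refine (degreeOf_mul_le _ _ _).trans ?_
  by_cases hi : i = a
  · subst hi
    rw [degreeOf_rename_val_eq_zero, add_zero]
    refine ((degreeOf_pow_le _ _ _).trans ?_).trans hd
    rw [degreeOf_X, if_pos rfl, mul_one]
    exact Nat.lt_succ_iff.1 (mem_range.1 hk)
  · rw [degreeOf_X_pow_of_ne _ hi, zero_add]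
    have h := hQ k hk ⟨i, hi⟩
    rwa [← degreeOf_rename_of_injective (Subtype.val_injective) (⟨i, hi⟩ : {i // i ≠ a})] at h

omit [Fintype σ] in
/-- **Inversion `z_a ↦ -1/z_a` preserves stability** for `f = Σ_{k≤d} z_a^k Q_k`:
`z_a^d f(-1/z_a,…) = Σ_k (-1)^{d-k} z_a^k Q_{d-k}` is stable with `f` (part I, Lemma 1.7 (3); tree:
`IsUpperHalfPlaneStable.invertVar`), here by the direct evaluation `g(z) = z_a^d f(…,-1/z_a,…)`.
[cite: BorceaBranden2009, §1 Lemma 1.7 (3)] [cite: BorceaBranden2009II, §6 Cor. 6.2] -/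
theorem isUpperHalfPlaneStable_sum_X_pow_mul_reverse {d : ℕ} {Q : ℕ → MvPolynomial {i // i ≠ a} ℂ}
    (hs : IsUpperHalfPlaneStable (∑ k ∈ range (d + 1), X a ^ k * rename (Subtype.val : {i // i ≠ a} → σ) (Q k) :
      MvPolynomial σ ℂ)) :
    IsUpperHalfPlaneStable (∑ k ∈ range (d + 1),
      X a ^ k * rename (Subtype.val : {i // i ≠ a} → σ) ((-1 : ℂ) ^ (d - k) • Q (d - k)) : MvPolynomial σ ℂ) := by
  intro z hz
  have hza : z a ≠ 0 := fun h => by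
    have := hz a
    rw [h, Complex.zero_im] at this
    exact lt_irrefl _ this
  set w : σ → ℂ := Function.update z a (-(z a)⁻¹) with hw
  have hw' : ∀ i, 0 < (w i).im := fun i => by
    by_cases hi : i = a
    · subst hi
      rw [hw, Function.update_self, Complex.neg_im, Complex.inv_im, neg_div, neg_neg]
      exact div_pos (hz i) (Complex.normSq_pos.2 hza)
    · rw [hw, Function.update_of_ne hi]
      exact hz i
  have hwval : (w ∘ (Subtype.val : {i // i ≠ a} → σ)) = z ∘ Subtype.val :=
    funext fun i => by simp only [Function.comp_apply, hw, Function.update_of_ne i.2]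
  have hf := hs w hw'
  -- `g(z) = z_a^d · f(w)`
  have key : eval z (∑ k ∈ range (d + 1), X a ^ k *
      rename (Subtype.val : {i // i ≠ a} → σ) ((-1 : ℂ) ^ (d - k) • Q (d - k)) : MvPolynomial σ ℂ) =
      z a ^ d * eval w (∑ k ∈ range (d + 1), X a ^ k * rename (Subtype.val : {i // i ≠ a} → σ) (Q k)) := by
    rw [map_sum, map_sum, mul_sum, ← sum_range_reflect]
    refine sum_congr rfl fun k hk => ?_
    have hk' : k ≤ d := Nat.lt_succ_iff.1 (mem_range.1 hk)
    rw [Nat.add_sub_cancel, Nat.sub_sub_self hk']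
    simp only [_root_.map_mul, map_pow, eval_X, map_smul, smul_eval, eval_rename]
    rw [hwval, hw, Function.update_self]
    have hpow : z a ^ d * (-(z a)⁻¹) ^ k = (-1) ^ k * z a ^ (d - k) := by
      obtain ⟨e, he⟩ := Nat.exists_eq_add_of_le hk'
      rw [he, Nat.add_sub_cancel_left, pow_add, neg_pow, inv_pow]
      field_simp
    linear_combination (eval (z ∘ (Subtype.val : {i // i ≠ a} → σ)) (Q k)) * hpow.symm
  rw [key]
  exact mul_ne_zero (pow_ne_zero _ hza) hf

/-- **Borcea–Brändén II, Corollary 6.2 for `R_d`.** Let `a ≠ b'`, `κ_a = κ_{b'} = d`, and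
`f = Σ_{k=0}^d z_a^k Q_k(z_2,…,z_n) ∈ ℂ_κ[z]` be stable. Then `R_d(f) = (1/d!) Σ_k (-1)^k (d-k)! (∂/∂z_{b'})^k Q_k` is
stable or identically zero. Proof as indicated there: `R_d = S_d ∘ (z_a ↦ -1/z_a)` (Lemma 6.1, Remark 3.1 and
part I, Lemma 1.7 (3)). [cite: BorceaBranden2009II, §6 Cor. 6.2] -/
theorem hardLiebSokalR_stable_or_eq_zero {a : σ} (b' : {i // i ≠ a}) {κ : σ → ℕ} {d : ℕ} (ha : κ a = d)
    (hb : κ b' = d) (Q : ℕ → MvPolynomial {i // i ≠ a} ℂ)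
    (hQ : ∀ k ∈ range (d + 1), ∀ i' : {i // i ≠ a}, degreeOf i' (Q k) ≤ κ i')
    (hs : IsUpperHalfPlaneStable (∑ k ∈ range (d + 1), X a ^ k * rename (Subtype.val : {i // i ≠ a} → σ) (Q k) :
      MvPolynomial σ ℂ)) :
    IsUpperHalfPlaneStable (hardLiebSokalR a b' d Q) ∨ hardLiebSokalR a b' d Q = 0 := by
  rw [hardLiebSokalR_eq]
  refine hardLiebSokalS_stable_or_eq_zero b' ha hb _ (degreeOf_sum_X_pow_mul_rename_le a ha.ge ?_)
    (isUpperHalfPlaneStable_sum_X_pow_mul_reverse a hs)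
  intro k hk i'
  have hk' : d - k ∈ range (d + 1) := mem_range.2 (Nat.lt_succ_of_le (Nat.sub_le d k))
  rw [smul_eq_C_mul]
  exact (degreeOf_C_mul_le _ _ _).trans (hQ (d - k) hk' i')

end Cor62R

/-! ## §6 Remark 6.1: `T_d(f)` is a polynomial in `z_a + z_b` and the other variables -/

section Remark61

variable (a b : σ)

omit [Fintype σ] [DecidableEq σ] in
/-- Mixed iterated derivatives of `z_a^i z_b^j q` for `q` free of `z_a, z_b`:
`∂_a^k ∂_b^l (z_a^i z_b^j q) = i^{(k)} j^{(l)} z_a^{i-k} z_b^{j-l} q` (descending factorials).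
[cite: BorceaBranden2009II, §6 Remark 6.1 (computation of `T_d` on monomials)] -/
theorem iterate_pderiv_X_pow_mul_X_pow_mul (hab : a ≠ b) {q : MvPolynomial σ ℂ} (hqa : pderiv a q = 0)
    (hqb : pderiv b q = 0) (i j k l : ℕ) :
    (pderiv a)^[k] ((pderiv b)^[l] (X a ^ i * X b ^ j * q)) =
      (((i.descFactorial k : ℕ) : ℂ) * ((j.descFactorial l : ℕ) : ℂ)) • (X a ^ (i - k) * X b ^ (j - l) * q) := by
  have hbq : pderiv b (X a ^ i * q : MvPolynomial σ ℂ) = 0 := by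
    rw [pderiv_mul, hqb, mul_zero, add_zero, pderiv_pow, pderiv_X_of_ne hab, mul_zero, zero_mul]
  have haq : pderiv a (X b ^ (j - l) * q : MvPolynomial σ ℂ) = 0 := by
    rw [pderiv_mul, hqa, mul_zero, add_zero, pderiv_pow, pderiv_X_of_ne (Ne.symm hab), mul_zero, zero_mul]
  calc (pderiv a)^[k] ((pderiv b)^[l] (X a ^ i * X b ^ j * q))
      = (pderiv a)^[k] ((pderiv b)^[l] (X b ^ j * (X a ^ i * q))) := by
        rw [mul_comm (X a ^ i) (X b ^ j), mul_assoc]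
    _ = (pderiv a)^[k] (((j.descFactorial l : ℕ) : ℂ) • (X a ^ i * (X b ^ (j - l) * q))) := by
        rw [iterate_pderiv_mul_of_right b hbq, iterate_pderiv_X_pow, smul_mul_assoc, ← mul_assoc,
          mul_comm (X b ^ (j - l)) (X a ^ i), mul_assoc]
    _ = ((j.descFactorial l : ℕ) : ℂ) • (((i.descFactorial k : ℕ) : ℂ) • (X a ^ (i - k) * (X b ^ (j - l) * q))) := by
        rw [iterate_pderiv_smul, iterate_pderiv_mul_of_right a haq, iterate_pderiv_X_pow, smul_mul_assoc]
    _ = _ := by rw [smul_smul, mul_comm ((j.descFactorial l : ℕ) : ℂ), mul_assoc]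

omit [Fintype σ] [DecidableEq σ] in
/-- The factorial bookkeeping behind the monomial formula: with `p = i - k` and `e = i + j - d`,
`i^{(k)} j^{(d-k)} · e! = binom(e,p) · i! · j!`. [cite: BorceaBranden2009II, §6 Remark 6.1 (computation of `T_d`
on monomials)] -/
private theorem descFactorial_mul_descFactorial_mul_factorial {d i j k : ℕ} (hj : j ≤ d) (hkd : k ≤ d)
    (hki : k ≤ i) (hjk : d - j ≤ k) :
    i.descFactorial k * j.descFactorial (d - k) * (i + j - d)! = (i + j - d).choose (i - k) * i ! * j ! := by
  have h1 : (i - k)! * i.descFactorial k = i ! := Nat.factorial_mul_descFactorial hki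
  have h2 : (j - (d - k))! * j.descFactorial (d - k) = j ! := Nat.factorial_mul_descFactorial (by omega)
  have h3 : (i + j - d).choose (i - k) * (i - k)! * (i + j - d - (i - k))! = (i + j - d)! :=
    Nat.choose_mul_factorial_mul_factorial (by omega)
  have h4 : i + j - d - (i - k) = j - (d - k) := by omega
  rw [h4] at h3
  rw [← h3, ← h1, ← h2]
  ring

omit [Fintype σ] [DecidableEq σ] in
/-- **`T_d` on monomials** (`a ≠ b`, `i, j ≤ d`, `q` free of `z_a, z_b`):
`T_d[z_a^i z_b^j q] = (i! j! / (d! (i+j-d)!)) (z_a + z_b)^{i+j-d} q` if `i + j ≥ d`, and `0` otherwise — in particular a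
polynomial in `z_a + z_b` times `q`. [cite: BorceaBranden2009II, §6 Remark 6.1 ("`T_d(f)` is actually a polynomial in
the `n-1` variables `z_1+z_2, z_3, …, z_n`")] -/
theorem hardLiebSokalOp_X_pow_mul_X_pow_mul (hab : a ≠ b) {d i j : ℕ} (hi : i ≤ d) (hj : j ≤ d)
    {q : MvPolynomial σ ℂ} (hqa : pderiv a q = 0) (hqb : pderiv b q = 0) :
    hardLiebSokalOp a b d (X a ^ i * X b ^ j * q) =
      if d ≤ i + j then
        (((i ! * j ! : ℕ) : ℂ) / ((d ! * (i + j - d)! : ℕ) : ℂ)) • ((X a + X b) ^ (i + j - d) * q)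
      else 0 := by
  rw [hardLiebSokalOp_apply]
  simp_rw [iterate_pderiv_X_pow_mul_X_pow_mul a b hab hqa hqb]
  -- the terms outside `d - j ≤ k ≤ i` vanish
  have hzero : ∀ k ∈ range (d + 1), ¬ (d - j ≤ k ∧ k ≤ i) →
      (((i.descFactorial k : ℕ) : ℂ) * ((j.descFactorial (d - k) : ℕ) : ℂ)) •
        (X a ^ (i - k) * X b ^ (j - (d - k)) * q : MvPolynomial σ ℂ) = 0 := by
    intro k hk hcond
    have hk' : k ≤ d := Nat.lt_succ_iff.1 (mem_range.1 hk)
    rcases not_and_or.1 hcond with h1 | h1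
    · rw [(Nat.descFactorial_eq_zero_iff_lt.2 (by omega) : j.descFactorial (d - k) = 0), Nat.cast_zero,
        mul_zero, zero_smul]
    · rw [(Nat.descFactorial_eq_zero_iff_lt.2 (by omega) : i.descFactorial k = 0), Nat.cast_zero, zero_mul,
        zero_smul]
  split_ifs with hd
  · set e := i + j - d with he
    -- restrict to the nonzero terms and reindex by `p = i - k`
    rw [← sum_filter_of_ne (p := fun k => d - j ≤ k ∧ k ≤ i)
      (fun k hk hne => by by_contra hc; exact hne (hzero k hk hc))]
    have hreindex : ∑ k ∈ (range (d + 1)).filter (fun k => d - j ≤ k ∧ k ≤ i),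
        (((i.descFactorial k : ℕ) : ℂ) * ((j.descFactorial (d - k) : ℕ) : ℂ)) •
          (X a ^ (i - k) * X b ^ (j - (d - k)) * q : MvPolynomial σ ℂ) =
        ∑ p ∈ range (e + 1), ((((i ! * j ! : ℕ) : ℂ) / ((e ! : ℕ) : ℂ)) * ((e.choose p : ℕ) : ℂ)) •
          (X a ^ p * X b ^ (e - p) * q : MvPolynomial σ ℂ) := by
      refine sum_nbij' (fun k => i - k) (fun p => i - p) (fun k hk => ?_) (fun p hp => ?_) (fun k hk => ?_)
        (fun p hp => ?_) (fun k hk => ?_)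
      · obtain ⟨hk, hk1, hk2⟩ := mem_filter.1 hk
        rw [mem_range]
        omega
      · rw [mem_range] at hp
        refine mem_filter.2 ⟨mem_range.2 (by omega), by omega, by omega⟩
      · obtain ⟨-, -, hk2⟩ := mem_filter.1 hk
        omega
      · rw [mem_range] at hp
        omega
      · obtain ⟨hk, hk1, hk2⟩ := mem_filter.1 hk
        have hkd : k ≤ d := Nat.lt_succ_iff.1 (mem_range.1 hk)
        have hexp : j - (d - k) = e - (i - k) := by omega
        have hnat := descFactorial_mul_descFactorial_mul_factorial (i := i) hj hkd hk2 hk1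
        rw [← he] at hnat
        have hnat' : ((i.descFactorial k : ℕ) : ℂ) * ((j.descFactorial (d - k) : ℕ) : ℂ) * ((e ! : ℕ) : ℂ) =
            ((e.choose (i - k) : ℕ) : ℂ) * ((i ! : ℕ) : ℂ) * ((j ! : ℕ) : ℂ) := by exact_mod_cast hnat
        have he0 : ((e ! : ℕ) : ℂ) ≠ 0 := Nat.cast_ne_zero.2 (Nat.factorial_ne_zero e)
        have hscal : ((i.descFactorial k : ℕ) : ℂ) * ((j.descFactorial (d - k) : ℕ) : ℂ) =
            (((i ! * j ! : ℕ) : ℂ) / ((e ! : ℕ) : ℂ)) * ((e.choose (i - k) : ℕ) : ℂ) := by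
          rw [div_mul_eq_mul_div, eq_div_iff he0]
          push_cast
          linear_combination hnat'
        rw [hexp, hscal]
    rw [hreindex, add_pow, sum_mul, smul_sum, smul_sum]
    refine sum_congr rfl fun p _ => ?_
    have hd0 : ((d ! : ℕ) : ℂ) ≠ 0 := Nat.cast_ne_zero.2 (Nat.factorial_ne_zero d)
    have he0 : ((e ! : ℕ) : ℂ) ≠ 0 := Nat.cast_ne_zero.2 (Nat.factorial_ne_zero e)
    have hscal : ((i ! * j ! : ℕ) : ℂ) / ((d ! * e ! : ℕ) : ℂ) =
        ((d ! : ℕ) : ℂ)⁻¹ * (((i ! * j ! : ℕ) : ℂ) / ((e ! : ℕ) : ℂ)) := by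
      push_cast
      field_simp
    rw [hscal, ← smul_smul, mul_smul, smul_eq_C_mul _ (((e.choose p : ℕ) : ℂ)), map_natCast]
    congr 2
    ring
  · rw [sum_eq_zero (fun k hk => hzero k hk (fun h => hd (by omega))), smul_zero]

omit [Fintype σ] [DecidableEq σ] in
/-- Splitting a monomial off its `z_a, z_b` part: `c z^m = z_a^{m_a} z_b^{m_b} · c z^{m''}` with `m''` vanishing at
`a, b`. [cite: BorceaBranden2009II, §6 Remark 6.1 (reduction to monomials)] -/
theorem monomial_eq_X_pow_mul_X_pow_mul_monomial (hab : a ≠ b) (m : σ →₀ ℕ) (c : ℂ) :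
    (monomial m c : MvPolynomial σ ℂ) = X a ^ m a * X b ^ m b * monomial ((m.erase a).erase b) c := by
  have hm : Finsupp.single a (m a) + Finsupp.single b (m b) + (m.erase a).erase b = m := by
    ext i
    simp only [Finsupp.add_apply]
    rcases eq_or_ne i a with rfl | hia
    · simp [hab]
    · rcases eq_or_ne i b with rfl | hib
      · simp [hia]
      · simp [hia, hib]
  rw [X_pow_eq_monomial, X_pow_eq_monomial, monomial_mul, monomial_mul, one_mul, one_mul, hm]

omit [Fintype σ] [DecidableEq σ] in
/-- A monomial whose exponent vanishes at `i` is killed by `∂_i`. [cite: BorceaBranden2009II, §6 Remark 6.1] -/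
theorem pderiv_monomial_eq_zero_of_apply_eq_zero {m : σ →₀ ℕ} {i : σ} (hm : m i = 0) (c : ℂ) :
    pderiv i (monomial m c : MvPolynomial σ ℂ) = 0 := by
  rw [pderiv_monomial, hm, Nat.cast_zero, mul_zero, map_zero]

omit [Fintype σ] in
/-- **Borcea–Brändén II, Remark 6.1, as the printed identity `F(z_1,z_2,…,z_n) = F(z_1+z_2, 0, z_3, …, z_n)`** for
`F = T_d(f)`, `f ∈ ℂ_κ[z]` with `κ_a = κ_b = d`: substituting `z_a ↦ z_a + z_b`, `z_b ↦ 0` does not change `T_d(f)`.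
Proof: by linearity from the monomial formula `T_d[z_a^i z_b^j q] = c (z_a+z_b)^{i+j-d} q`.
[cite: BorceaBranden2009II, §6 Remark 6.1] -/
theorem bind₁_hardLiebSokalOp_add_zero (hab : a ≠ b) {d : ℕ} {f : MvPolynomial σ ℂ} (hfa : degreeOf a f ≤ d)
    (hfb : degreeOf b f ≤ d) :
    bind₁ (Function.update (Function.update X b 0) a (X a + X b)) (hardLiebSokalOp a b d f) =
      hardLiebSokalOp a b d f := by
  set ψ : σ → MvPolynomial σ ℂ := Function.update (Function.update X b 0) a (X a + X b) with hψ
  have hψa : ψ a = X a + X b := by rw [hψ, Function.update_self]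
  have hψb : ψ b = 0 := by rw [hψ, Function.update_of_ne (Ne.symm hab), Function.update_self]
  have hψi : ∀ i, i ≠ a → i ≠ b → ψ i = X i := fun i hia hib => by
    rw [hψ, Function.update_of_ne hia, Function.update_of_ne hib]
  rw [f.as_sum, map_sum, map_sum]
  refine sum_congr rfl fun m hm => ?_
  have hma : m a ≤ d := (monomial_le_degreeOf a hm).trans hfa
  have hmb : m b ≤ d := (monomial_le_degreeOf b hm).trans hfb
  set m'' := (m.erase a).erase b with hm''
  have hm''a : m'' a = 0 := by
    rw [hm'', Finsupp.erase_ne hab, Finsupp.erase_same]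
  have hm''b : m'' b = 0 := by rw [hm'', Finsupp.erase_same]
  have hfix : bind₁ ψ (monomial m'' (coeff m f)) = monomial m'' (coeff m f) := by
    rw [bind₁_monomial, monomial_eq, Finsupp.prod]
    congr 1
    refine prod_congr rfl fun i hi => ?_
    have hi' := hi
    rw [hm'', Finsupp.support_erase, mem_erase, Finsupp.support_erase, mem_erase] at hi'
    rw [hψi i hi'.2.1 hi'.1]
  rw [monomial_eq_X_pow_mul_X_pow_mul_monomial a b hab m,
    hardLiebSokalOp_X_pow_mul_X_pow_mul a b hab hma hmb (pderiv_monomial_eq_zero_of_apply_eq_zero hm''a _)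
      (pderiv_monomial_eq_zero_of_apply_eq_zero hm''b _)]
  split_ifs with h
  · rw [map_smul, _root_.map_mul, map_pow, map_add, bind₁_X_right, bind₁_X_right, hψa, hψb, add_zero, hfix]
  · rw [map_zero]

omit [Fintype σ] in
/-- **Borcea–Brändén II, Remark 6.1: "`T_d(f)` is actually a polynomial in the `n-1` variables
`z_1 + z_2, z_3, …, z_n` for any `f ∈ ℂ_κ[z_1,…,z_n]`"** (`κ_1 = κ_2 = d`; here the two variables are `a ≠ b`): there
is a polynomial `G` not involving `z_b` with `T_d(f) = G(z_a ↦ z_a + z_b)`. (`G = T_d(f)|_{z_b = 0}`.)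
[cite: BorceaBranden2009II, §6 Remark 6.1] -/
theorem exists_hardLiebSokalOp_eq_bind₁_add (hab : a ≠ b) {d : ℕ} {f : MvPolynomial σ ℂ} (hfa : degreeOf a f ≤ d)
    (hfb : degreeOf b f ≤ d) :
    ∃ G : MvPolynomial σ ℂ, b ∉ G.vars ∧
      hardLiebSokalOp a b d f = bind₁ (Function.update X a (X a + X b)) G := by
  refine ⟨bind₁ (Function.update X b 0) (hardLiebSokalOp a b d f), fun hb => ?_, ?_⟩
  · obtain ⟨i, -, hi⟩ := mem_biUnion.1 (vars_bind₁ _ _ hb)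
    by_cases hib : i = b
    · subst hib
      rw [Function.update_self, vars_0] at hi
      exact notMem_empty _ hi
    · rw [Function.update_of_ne hib, vars_X, mem_singleton] at hi
      exact hib hi.symm
  · have hfun : (fun i => bind₁ (Function.update X a (X a + X b : MvPolynomial σ ℂ))
        (Function.update (X : σ → MvPolynomial σ ℂ) b 0 i)) =
        Function.update (Function.update X b 0) a (X a + X b) := by
      funext i
      by_cases hib : i = b
      · subst hib
        rw [Function.update_self, map_zero, Function.update_of_ne (Ne.symm hab), Function.update_self]
      · by_cases hia : i = a
        · subst hia
          rw [Function.update_of_ne hab, bind₁_X_right, Function.update_self, Function.update_self]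
        · rw [Function.update_of_ne hib, bind₁_X_right, Function.update_of_ne hia, Function.update_of_ne hia,
            Function.update_of_ne hib]
    rw [bind₁_bind₁, hfun, bind₁_hardLiebSokalOp_add_zero a b hab hfa hfb]

omit [Fintype σ] in
/-- **Remark 6.1, translation form: `F(z_a + t, z_b - t, z_3, …, z_n) = F(z_a, z_b, …, z_n)`** for `F = T_d(f)` and
every `t` (the printed "`∂/∂t F(z_1+t, z_2-t, z_3, …, z_n) = 0`"; here `t` may be any polynomial).
[cite: BorceaBranden2009II, §6 Remark 6.1] -/
theorem bind₁_hardLiebSokalOp_translate (hab : a ≠ b) {d : ℕ} {f : MvPolynomial σ ℂ} (hfa : degreeOf a f ≤ d)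
    (hfb : degreeOf b f ≤ d) (t : MvPolynomial σ ℂ) :
    bind₁ (Function.update (Function.update X b (X b - t)) a (X a + t)) (hardLiebSokalOp a b d f) =
      hardLiebSokalOp a b d f := by
  obtain ⟨G, hGb, hG⟩ := exists_hardLiebSokalOp_eq_bind₁_add a b hab hfa hfb
  rw [hG, bind₁_bind₁]
  refine hom_congr_vars (RingHom.ext fun c => ?_) (fun i hi _ => ?_) rfl
  · change bind₁ _ (C c) = bind₁ _ (C c)
    rw [bind₁_C_right, bind₁_C_right]
  · have hib : i ≠ b := fun h => hGb (h ▸ hi)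
    change bind₁ _ (X i) = bind₁ _ (X i)
    rw [bind₁_X_right, bind₁_X_right]
    by_cases hia : i = a
    · subst hia
      rw [Function.update_self, map_add, bind₁_X_right, bind₁_X_right, Function.update_self,
        Function.update_of_ne (Ne.symm hab), Function.update_self]
      ring
    · rw [Function.update_of_ne hia, bind₁_X_right, Function.update_of_ne hia, Function.update_of_ne hib]

end Remark61

end Literature.Combinatorics.StablePolynomials

end
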